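import Literature.RepresentationTheory.Semisimple.EquivOfCharacter
import Literature.RepresentationTheory.Semisimple.Twist
import Literature.NumberTheory.GaloisRepresentations.LAdicRepFrobenius
import Literature.NumberTheory.GaloisRepresentations.AbsGaloisOuterConj
import Literature.NumberTheory.GaloisRepresentations.GlobalArtinMapOfCharactersProofs
import Literature.NumberTheory.Automorphic.ClassFieldCharacterFrobenius
import Literature.NumberTheory.Automorphic.ChebotarevArtinRepHolds
import Literature.NumberTheory.Automorphic.TunnellOctahedralGlobal
import Literature.NumberTheory.Automorphic.ReciprocityGLn
import Mathlib.FieldTheory.Galois.Infinite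
import HarnessLib

/-!
# Self-twists of two-dimensional Galois representations by quadratic characters, and the
# "inert place with `-α ≠ α`" hypothesis of cyclic base change

Topic `Literature/NumberTheory/Automorphic`; a *proofs* file (theorems only — no definition, no
named fact), written for the seat of `Langlands1980_quadraticBaseChange_frobCompatible`
(`QuadraticBaseChangeFrobCompatibleCarayolProofs`, auxiliary-field argument).  The named fact
`baseChange_cyclic_cuspidal` (Arthur–Clozel, Ch. 3 Thm. 4.2 (a)) renders its hypothesis
"`π ≇ π ⊗ η_{E/K}`" on unramified data: some place `v` of `K` inert in the quadratic `E` carries a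
Satake parameter `α` of `π` with `-α ≠ α`.  This file derives that hypothesis from the Galois side
in the form needed when `ρ|_{Γ_E}` may be REDUCIBLE (the Summit file
`…QuadraticBaseChangeTwistNonDihedral` treats the irreducible case), and bounds the number of
quadratic characters `η` with `ρ ⊗ η ≅ ρ`:

* `LinearMap.trace_eq_zero_of_mapsTo_of_isCompl` — an endomorphism exchanging two complementary
  subspaces has trace `0`;
* `linearIndependent_of_forall_conj_eq_smul` — simultaneous eigenvectors of a family of operators
  with pairwise distinct eigen-characters are linearly independent; whence
  `Representation.card_le_finrank_sq_of_forall_twist_equiv`: **a non-zero representation `ρ` of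
  dimension `d` has at most `d²` self-twists** `ρ ⊗ χ ≅ ρ` (the intertwiners are simultaneous
  eigenvectors of `X ↦ ρ(g) X ρ(g)⁻¹` on `End V` with the pairwise distinct characters `χ`);
* `FramedGaloisRep.nonempty_twist_equiv_of_trace_eq_zero` — if `tr ρ` vanishes wherever the
  `±1`-valued character `η` is `-1`, then `ρ ⊗ η ≅ ρ` for `ρ` semisimple (Brauer–Nesbitt in
  characteristic `0`, the tree's `Representation.nonempty_equiv_of_character_eq_of_isSemisimple`);
* `absoluteGaloisGroup.exists_quadraticChar_of_smul_sq_eq` — the quadratic character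
  `γ ↦ γ(s)/s ∈ {±1}` of `Γ_K` attached to a square root `s ∈ K̄` of an element of `K`, and
  `absoluteGaloisGroup.exists_smul_ne_of_not_mem_range` (an element of `K̄ ∖ K` is moved by `Γ_K`,
  Mathlib's infinite Galois correspondence);
* `FramedGaloisRep.exists_smul_eq_neg_and_trace_ne_zero` — **among five square roots
  `t₁, …, t₅ ∈ K̄` of elements of `K` with `tᵢ tⱼ ∉ K` (`i ≠ j`), some `tⱼ` is negated by an
  element of non-zero trace** under any semisimple `ρ : Γ_K → GL₂(k)`, `char k = 0` (five pairwise
  distinct quadratic characters cannot all be self-twists of a `2`-dimensional `ρ`);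
* `FramedGaloisRep.trace_eq_zero_of_not_isIrreducible_restrictField` — if `ρ : Γ_K → GL₂(k)` is
  irreducible but `ρ|_{Γ_E}` is not (`E/K` quadratic), then `tr ρ = 0` off `res(Γ_E)` (the
  `Γ_E`-stable line and its translate are exchanged); so an element off `res(Γ_E)` of non-zero
  trace makes `ρ|_{Γ_E}` irreducible (`isIrreducible_restrictField_of_trace_ne_zero`);
* `exists_inert_hasSatakeParamAt_map_ne_of_trace_ne_zero` — **the hypothesis of
  `baseChange_cyclic_cuspidal` from one element `γ ∉ res(Γ_E)` with `tr ρ(γ) ≠ 0`**, for `ρ`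
  Satake–Frobenius compatible with `π` almost everywhere: the open set
  `{ε_E = -1, tr ρ ≠ 0} ∋ γ` contains an arithmetic Frobenius at a good place `v` (Chebotarev,
  `absoluteGaloisGroup.frobenius_dense` with `chebotarev_artinRep_holds`); `ε_E(Frob_v) = -1`
  forces `v` inert, and `tr ρ(Frob_v) ≠ 0` forces `-α ≠ α` (Ribet 1977, §4: CM by `E` iff
  `a_v = 0` at the inert `v`).

## References

* K. A. Ribet, *Galois representations attached to eigenforms with Nebentypus*, Modular functions
  of one variable V, LNM 601 (1977), §4 (Prop. 4.4, Thm. 4.5). [Ribet1977Nebentypus]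
* J. Arthur, L. Clozel, *Simple algebras, base change, and the advanced theory of the trace
  formula*, Ann. of Math. Stud. 120 (1989), Ch. 3, Thm. 4.2 and proof of Thm. 3.1. [ArthurClozelAMS120]
* J.-P. Serre, *Abelian ℓ-adic representations and elliptic curves* (1968), Ch. I §2.2
  (Chebotarev, density of Frobenii). [SerreAbelianLadic1968]
* C. W. Curtis, I. Reiner, *Methods of Representation Theory* I (1981), §10 (twisting by linear
  characters) and (3.17)–(3.20). [folklore]
-/

noncomputable section

open scoped MatrixGroups Matrix NumberField Polynomial
open NumberField IsDedekindDomain Field Polynomial Filter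
open Literature.RepresentationTheory.Semisimple

namespace Literature.NumberTheory.GaloisRepresentations

/-! ## 1. Linear algebra: exchanging operators have trace zero; simultaneous eigenvectors -/

section LinearAlgebra

variable {k : Type*} [Field k] {V : Type*} [AddCommGroup V] [Module k V]

/-- **An endomorphism exchanging two complementary subspaces has trace zero**: if
`V = W ⊕ W'`, `T(W) ⊆ W'` and `T(W') ⊆ W`, then `tr T = 0`.  With the projector `E` onto `W`
along `W'`: `tr T = tr (E T) + tr ((1 - E) T) = tr (E T E) + tr ((1 - E) T (1 - E)) = 0`.
[folklore] -/
theorem LinearMap.trace_eq_zero_of_mapsTo_of_isCompl [FiniteDimensional k V] {W W' : Submodule k V}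
    (h : IsCompl W W') (T : V →ₗ[k] V) (hW : ∀ x ∈ W, T x ∈ W') (hW' : ∀ x ∈ W', T x ∈ W) :
    LinearMap.trace k V T = 0 := by
  set E : V →ₗ[k] V := W.projection W' h with hE
  have hEmem : ∀ x, E x ∈ W := fun x ↦ Submodule.projection_apply_mem h x
  have hEleft : ∀ x ∈ W, E x = x := fun x hx ↦ Submodule.projection_apply_of_mem_left h hx
  have hEright : ∀ x ∈ W', E x = 0 := fun x hx ↦ Submodule.projection_apply_right h ⟨x, hx⟩
  have hsub : ∀ x, x - E x ∈ W' := fun x ↦ Submodule.sub_projection_mem h x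
  have hEE : E * E = E := LinearMap.ext fun x ↦ hEleft _ (hEmem x)
  have h1 : E * T * E = 0 := LinearMap.ext fun x ↦ by
    change E (T (E x)) = 0
    exact hEright _ (hW _ (hEmem x))
  have h2 : (1 - E) * T * (1 - E) = 0 := LinearMap.ext fun x ↦ by
    change (1 - E) (T ((1 - E) x)) = 0
    have hx : (1 - E) x = x - E x := rfl
    have hy := hW' _ (hx ▸ hsub x)
    change T ((1 - E) x) - E (T ((1 - E) x)) = 0
    rw [hEleft _ hy, sub_self]
  have h11 : (1 - E) * (1 - E) = 1 - E := by
    rw [mul_sub, sub_mul, one_mul, mul_one, sub_mul, one_mul, hEE, sub_self, sub_zero]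
  calc LinearMap.trace k V T
      = LinearMap.trace k V (E * T) + LinearMap.trace k V ((1 - E) * T) := by
        rw [← map_add, ← add_mul, add_sub_cancel, one_mul]
    _ = LinearMap.trace k V (E * (E * T)) + LinearMap.trace k V ((1 - E) * ((1 - E) * T)) := by
        rw [← mul_assoc, hEE, ← mul_assoc, h11]
    _ = LinearMap.trace k V (E * T * E) + LinearMap.trace k V ((1 - E) * T * (1 - E)) := by
        rw [LinearMap.trace_mul_comm k E (E * T), LinearMap.trace_mul_comm k (1 - E) ((1 - E) * T)]
    _ = 0 := by rw [h1, h2, map_zero, add_zero]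

/-- **Simultaneous eigenvectors with pairwise distinct eigen-characters are linearly
independent**: if `T_h (v_i) = χ_i(h) v_i` for all `h`, the `v_i` are non-zero and `χ_i ≠ χ_j`
(as functions of `h`) for `i ≠ j`, then `(v_i)` is linearly independent (induction on a
dependence relation, applying `T_h - χ_{i₀}(h)` to shorten it). [folklore] -/
theorem linearIndependent_of_forall_conj_eq_smul {M : Type*} [AddCommGroup M] [Module k M]
    {ι H : Type*} (T : H → M →ₗ[k] M) (χ : ι → H → k) (v : ι → M)
    (hv : ∀ i h, T h (v i) = χ i h • v i) (hne : ∀ i, v i ≠ 0)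
    (hχ : ∀ i j, i ≠ j → ∃ h, χ i h ≠ χ j h) : LinearIndependent k v := by
  classical
  rw [linearIndependent_iff']
  intro s
  induction s using Finset.induction_on with
  | empty => intro c _ i hi; exact absurd hi (Finset.notMem_empty i)
  | insert i₀ s hi₀ ih =>
    intro c hc
    have key : ∀ h, ∀ j ∈ s, c j * (χ j h - χ i₀ h) = 0 := by
      intro h
      apply ih
      have h1 := congrArg (T h) hc
      rw [map_sum, map_zero] at h1
      simp_rw [map_smul, hv] at h1
      have h2 : ∑ j ∈ insert i₀ s, (c j * (χ j h - χ i₀ h)) • v j = 0 := by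
        have e : ∀ j, (c j * (χ j h - χ i₀ h)) • v j = c j • χ j h • v j - χ i₀ h • c j • v j :=
          fun j ↦ by rw [mul_sub, sub_smul, mul_smul, mul_comm (c j), mul_smul]
        simp_rw [e, Finset.sum_sub_distrib, ← Finset.smul_sum, h1, hc, smul_zero, sub_zero]
      rwa [Finset.sum_insert hi₀, sub_self, mul_zero, zero_smul, zero_add] at h2
    have hcs : ∀ j ∈ s, c j = 0 := fun j hj ↦ by
      obtain ⟨h, hh⟩ := hχ j i₀ (ne_of_mem_of_not_mem hj hi₀)
      exact (mul_eq_zero.mp (key h j hj)).resolve_right (sub_ne_zero.mpr hh)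
    have hci₀ : c i₀ = 0 := by
      rw [Finset.sum_insert hi₀, Finset.sum_eq_zero (fun j hj ↦ by rw [hcs j hj, zero_smul]),
        add_zero] at hc
      exact (smul_eq_zero.mp hc).resolve_right (hne i₀)
    intro i hi
    rcases Finset.mem_insert.mp hi with rfl | hi
    · exact hci₀
    · exact hcs i hi

end LinearAlgebra

/-! ## 2. At most `d²` self-twists -/

section SelfTwist

variable {k : Type*} [Field k] {G : Type*} [Group G] {V : Type*} [AddCommGroup V] [Module k V]

/-- **A non-zero representation of dimension `d` has at most `d²` self-twists.**  If
`ρ ⊗ χ ≅ ρ` for every `χ` in a finite set `s` of characters, then `#s ≤ (dim V)²`: an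
equivalence `A_χ : ρ ⊗ χ ≅ ρ` satisfies `ρ(g) A_χ ρ(g)⁻¹ = χ(g) A_χ`, so the `A_χ` are
simultaneous eigenvectors of the conjugation operators on `End V` with the pairwise distinct
characters `χ ∈ s`, hence linearly independent in the `d²`-dimensional `End V`
(`linearIndependent_of_forall_conj_eq_smul`). [folklore] -/
theorem Representation.card_le_finrank_sq_of_forall_twist_equiv [FiniteDimensional k V]
    [Nontrivial V] (ρ : Representation k G V) (s : Finset (G →* kˣ))
    (hs : ∀ χ ∈ s, Nonempty ((Representation.twist ρ χ).Equiv ρ)) :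
    s.card ≤ Module.finrank k V ^ 2 := by
  classical
  -- the eigen-intertwiners
  let A : s → Module.End k V := fun χ ↦ ((hs χ.1 χ.2).some.toLinearEquiv : V →ₗ[k] V)
  have hAeq : ∀ (χ : s) (g : G), A χ ∘ₗ (Representation.twist ρ χ.1 g) = ρ g ∘ₗ A χ :=
    fun χ g ↦ (hs χ.1 χ.2).some.isIntertwining' g
  -- conjugation operators on `End V`
  let T : G → Module.End k V →ₗ[k] Module.End k V :=
    fun g ↦ (LinearMap.mulLeft k (ρ g)) ∘ₗ (LinearMap.mulRight k (ρ g⁻¹))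
  have hT : ∀ g X, T g X = ρ g * X * ρ g⁻¹ := fun g X ↦ by
    simp only [T, LinearMap.coe_comp, Function.comp_apply, LinearMap.mulRight_apply,
      LinearMap.mulLeft_apply, mul_assoc]
  have hinv : ∀ g : G, ρ g * ρ g⁻¹ = 1 := fun g ↦ by rw [← map_mul, mul_inv_cancel, map_one]
  have hA : ∀ (χ : s) g, T g (A χ) = ((χ.1 g : kˣ) : k) • A χ := fun χ g ↦ by
    rw [hT]
    have h1 : A χ * (((χ.1 g : kˣ) : k) • ρ g) = ρ g * A χ := hAeq χ g
    -- `A (χ g • ρ g) = ρ g A`, so `ρ g A ρ g⁻¹ = χ g • A`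
    have h2 : ρ g * A χ * ρ g⁻¹ = ((χ.1 g : kˣ) : k) • (A χ * ρ g * ρ g⁻¹) := by
      rw [← h1, mul_smul_comm, smul_mul_assoc]
    rw [h2, mul_assoc, hinv, mul_one]
  have hne : ∀ χ : s, A χ ≠ 0 := fun χ h0 ↦ by
    obtain ⟨x, hx⟩ := exists_ne (0 : V)
    apply hx
    have h1 : (hs χ.1 χ.2).some.toLinearEquiv x = 0 := by
      change A χ x = 0
      rw [h0, LinearMap.zero_apply]
    exact (map_eq_zero_iff _ (hs χ.1 χ.2).some.toLinearEquiv.injective).mp h1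
  have hχ : ∀ χ χ' : s, χ ≠ χ' → ∃ g, ((χ.1 g : kˣ) : k) ≠ ((χ'.1 g : kˣ) : k) := by
    intro χ χ' hne'
    by_contra hall
    push Not at hall
    exact hne' (Subtype.ext (MonoidHom.ext fun g ↦ Units.val_injective (hall g)))
  have hli := linearIndependent_of_forall_conj_eq_smul T (fun (χ : s) g ↦ ((χ.1 g : kˣ) : k)) A
    hA hne hχ
  have hcard := hli.fintype_card_le_finrank
  rw [Fintype.card_coe, Module.finrank_linearMap, ← pow_two] at hcard
  exact hcard

end SelfTwist

/-! ## 3. Quadratic characters of `Γ_K` attached to square roots, and self-twists of `ρ` -/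

section QuadChar

variable {K : Type*} [Field K] [CharZero K]

omit [CharZero K] in
/-- `Γ_K` moves a square root `s` of an element of `K` to `±s`. [folklore] -/
theorem absoluteGaloisGroup.smul_eq_or_eq_neg_of_smul_sq_eq {s : AlgebraicClosure K}
    (hs : ∀ g : absoluteGaloisGroup K, g • (s ^ 2) = s ^ 2) (g : absoluteGaloisGroup K) :
    g • s = s ∨ g • s = -s := by
  have h1 : (g • s) ^ 2 = s ^ 2 := by rw [← smul_pow', hs g]
  exact sq_eq_sq_iff_eq_or_eq_neg.mp h1

/-- **The quadratic character of `Γ_K` attached to a square root.**  For `s ∈ K̄` with `s²`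
fixed by `Γ_K` and `s ≠ 0` there is a homomorphism `η : Γ_K → Aˣ` with `η(g) = 1` if `g s = s`
and `η(g) = -1` if `g s ≠ s` (then `g s = -s`). [folklore] -/
theorem absoluteGaloisGroup.exists_quadraticChar_of_smul_sq_eq (A : Type*) [CommRing A]
    {s : AlgebraicClosure K} (hs0 : s ≠ 0)
    (hs : ∀ g : absoluteGaloisGroup K, g • (s ^ 2) = s ^ 2) :
    ∃ η : absoluteGaloisGroup K →* Aˣ, (∀ g, g • s = s → η g = 1) ∧ (∀ g, g • s ≠ s → η g = -1) := by
  classical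
  have hss : s ≠ -s := fun h ↦ hs0 (by
    have h2 : (2 : AlgebraicClosure K) * s = 0 := by rw [two_mul]; nth_rewrite 2 [h]; exact add_neg_cancel s
    exact (mul_eq_zero.mp h2).resolve_left two_ne_zero)
  have hdich := absoluteGaloisGroup.smul_eq_or_eq_neg_of_smul_sq_eq hs
  refine ⟨⟨⟨fun g ↦ if g • s = s then 1 else -1, by simp⟩, fun g h ↦ ?_⟩,
    fun g hg ↦ if_pos hg, fun g hg ↦ if_neg hg⟩
  change (if (g * h) • s = s then (1 : Aˣ) else -1) =
    (if g • s = s then (1 : Aˣ) else -1) * (if h • s = s then (1 : Aˣ) else -1)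
  rw [mul_smul]
  rcases hdich h with hh | hh <;> rcases hdich g with hg | hg
  · simp [hh, hg]
  · simp [hh, hg, hss.symm]
  · simp [hh, hg, smul_neg, hss.symm]
  · simp [hh, hg, smul_neg, hss.symm]

/-- **`Γ_K` moves every element of `K̄ ∖ K`** (the fixed field of `Γ_K = Gal(K̄/K)` is `K`:
Mathlib `InfiniteGalois.fixedField_fixingSubgroup` at `⊥`, `K̄/K` being Galois in
characteristic zero). [folklore] -/
theorem absoluteGaloisGroup.exists_smul_ne_of_not_mem_range {x : AlgebraicClosure K}
    (hx : x ∉ Set.range (algebraMap K (AlgebraicClosure K))) :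
    ∃ g : absoluteGaloisGroup K, g • x ≠ x := by
  by_contra h
  push Not at h
  apply hx
  have hmem : x ∈ IntermediateField.fixedField
      ((⊥ : IntermediateField K (AlgebraicClosure K)).fixingSubgroup) := by
    rw [IntermediateField.mem_fixedField_iff]
    intro f _
    have := h ((absoluteGaloisGroup.toAlgEquiv K).symm f)
    rwa [absoluteGaloisGroup.toAlgEquiv_symm_apply] at this
  rw [InfiniteGalois.fixedField_fixingSubgroup, IntermediateField.mem_bot] at hmem
  exact hmem

end QuadChar

section GaloisSelfTwist

variable {K : Type} [Field K] [CharZero K] {k : Type*} [Field k] [TopologicalSpace k]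
  [IsTopologicalRing k] {n : ℕ}

omit [CharZero K] in
/-- **Vanishing traces give a self-twist** (Brauer–Nesbitt in characteristic zero): if
`ρ : Γ_K → GL_n(k)` is semisimple, `char k = 0`, and `η : Γ_K → kˣ` satisfies, for every `g`,
`η(g) = 1` or (`η(g) = -1` and `tr ρ(g) = 0`), then `ρ ⊗ η` and `ρ` have the same character, hence
are equivalent (`Representation.nonempty_equiv_of_character_eq_of_isSemisimple`).
[cite: BourbakiAlgebreVIII2012, VIII § 20 n° 6, Cor. a) de la Prop. 6] -/
theorem FramedGaloisRep.nonempty_twist_equiv_of_trace_eq_zero [CharZero k] (ρ : FramedGaloisRep K k n)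
    (hss : ρ.toGaloisRep.IsSemisimple) (η : absoluteGaloisGroup K →* kˣ)
    (hη : ∀ g, η g = 1 ∨ (η g = -1 ∧ FramedRep.trace ρ g = 0)) :
    Nonempty ((Representation.twist ρ.toGaloisRep.toRepresentation η).Equiv
      ρ.toGaloisRep.toRepresentation) := by
  haveI : ρ.toGaloisRep.toRepresentation.IsSemisimpleRepresentation := hss
  haveI : (Representation.twist ρ.toGaloisRep.toRepresentation η).IsSemisimpleRepresentation :=
    (Representation.isSemisimpleRepresentation_twist_iff _ η).mpr hss
  refine Representation.nonempty_equiv_of_character_eq_of_isSemisimple _ _ (funext fun g ↦ ?_)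
  have e1 : (Representation.twist ρ.toGaloisRep.toRepresentation η).character g =
      ((η g : kˣ) : k) * ρ.toGaloisRep.toRepresentation.character g := by
    change LinearMap.trace k _ (((η g : kˣ) : k) • ρ.toGaloisRep.toRepresentation g) =
      ((η g : kˣ) : k) * LinearMap.trace k _ (ρ.toGaloisRep.toRepresentation g)
    rw [map_smul, smul_eq_mul]
  rw [e1, FramedGaloisRep.character_toRepresentation]
  rcases hη g with h1 | ⟨h1, h2⟩
  · rw [h1, Units.val_one, one_mul]
  · rw [h2, mul_zero]

/-- **Five square roots cannot all be "trace-killing".**  Let `ρ : Γ_K → GL₂(k)` be semisimple,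
`char k = 0`, and `t₁, …, t₅ ∈ K̄` non-zero with `tⱼ²` fixed by `Γ_K` and `tᵢ tⱼ ∉ K` for
`i ≠ j`.  Then for some `j` there is `γ ∈ Γ_K` with `γ tⱼ = -tⱼ` and `tr ρ(γ) ≠ 0`.  Otherwise
the five quadratic characters `ηⱼ` of `exists_quadraticChar_of_smul_sq_eq` are self-twists of
`ρ` (`nonempty_twist_equiv_of_trace_eq_zero`) and pairwise distinct (an element of `Γ_K` moving
`tᵢ tⱼ`, `exists_smul_ne_of_not_mem_range`, separates `ηᵢ` from `ηⱼ`), contradicting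
`Representation.card_le_finrank_sq_of_forall_twist_equiv` (`5 ≤ 4`). [folklore] -/
theorem FramedGaloisRep.exists_smul_eq_neg_and_trace_ne_zero [CharZero k] (ρ : FramedGaloisRep K k 2)
    (hss : ρ.toGaloisRep.IsSemisimple) (t : Fin 5 → AlgebraicClosure K) (ht0 : ∀ j, t j ≠ 0)
    (ht : ∀ j (g : absoluteGaloisGroup K), g • (t j ^ 2) = t j ^ 2)
    (hdist : ∀ i j, i ≠ j → t i * t j ∉ Set.range (algebraMap K (AlgebraicClosure K))) :
    ∃ j, ∃ γ : absoluteGaloisGroup K, γ • t j = -t j ∧ FramedRep.trace ρ γ ≠ 0 := by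
  classical
  by_contra H
  push Not at H
  have h11 : (1 : kˣ) ≠ -1 := fun h ↦ by
    have h2 : ((1 : kˣ) : k) = ((-1 : kˣ) : k) := congrArg Units.val h
    rw [Units.val_one, Units.val_neg, Units.val_one] at h2
    exact two_ne_zero (α := k) (by linear_combination h2)
  -- the five characters
  choose η hη1 hη2 using fun j ↦
    absoluteGaloisGroup.exists_quadraticChar_of_smul_sq_eq k (ht0 j) (ht j)
  have hdich := fun j ↦ absoluteGaloisGroup.smul_eq_or_eq_neg_of_smul_sq_eq (ht j)
  -- all are self-twists
  have hself : ∀ j, Nonempty ((Representation.twist ρ.toGaloisRep.toRepresentation (η j)).Equiv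
      ρ.toGaloisRep.toRepresentation) := fun j ↦ by
    refine ρ.nonempty_twist_equiv_of_trace_eq_zero hss (η j) fun g ↦ ?_
    rcases hdich j g with hg | hg
    · exact Or.inl (hη1 j g hg)
    · have hne : g • t j ≠ t j := by
        rw [hg]
        intro h
        have h2 : (2 : AlgebraicClosure K) * t j = 0 := by
          rw [two_mul]; nth_rewrite 1 [← h]; exact neg_add_cancel (t j)
        exact ht0 j ((mul_eq_zero.mp h2).resolve_left two_ne_zero)
      exact Or.inr ⟨hη2 j g hne, H j g hg⟩
  -- pairwise distinct
  have hinj : Function.Injective η := by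
    intro i j hij
    by_contra hne
    obtain ⟨g, hg⟩ := absoluteGaloisGroup.exists_smul_ne_of_not_mem_range (hdist i j hne)
    rw [smul_mul'] at hg
    rcases hdich i g with hi | hi <;> rcases hdich j g with hj | hj
    · exact hg (by rw [hi, hj])
    · have h1 : η i g = 1 := hη1 i g hi
      have h2 : η j g = -1 := hη2 j g (by
        rw [hj]; intro h
        have h3 : (2 : AlgebraicClosure K) * t j = 0 := by
          rw [two_mul]; nth_rewrite 1 [← h]; exact neg_add_cancel (t j)
        exact ht0 j ((mul_eq_zero.mp h3).resolve_left two_ne_zero))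
      rw [hij] at h1
      exact h11 (h1.symm.trans h2)
    · have h1 : η j g = 1 := hη1 j g hj
      have h2 : η i g = -1 := hη2 i g (by
        rw [hi]; intro h
        have h3 : (2 : AlgebraicClosure K) * t i = 0 := by
          rw [two_mul]; nth_rewrite 1 [← h]; exact neg_add_cancel (t i)
        exact ht0 i ((mul_eq_zero.mp h3).resolve_left two_ne_zero))
      rw [hij] at h2
      exact h11 (h1.symm.trans h2)
    · exact hg (by rw [hi, hj, neg_mul_neg])
  -- count
  haveI : Nontrivial (Fin 2 → k) := inferInstance
  have hle := Representation.card_le_finrank_sq_of_forall_twist_equiv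
    ρ.toGaloisRep.toRepresentation (Finset.univ.image η) (fun χ hχ ↦ by
      obtain ⟨j, -, rfl⟩ := Finset.mem_image.mp hχ
      exact hself j)
  rw [Finset.card_image_of_injective _ hinj, Finset.card_univ, Fintype.card_fin,
    Module.finrank_fin_fun] at hle
  omega

end GaloisSelfTwist

/-! ## 4. Irreducibility of `ρ|_{Γ_E}` from one element of non-zero trace off `res(Γ_E)` -/

section TwoElement

variable {G : Type*} [Group G] (A : Type*) [CommRing A]

open scoped Classical in
/-- **The sign character of a group of order two**, `1 ↦ 1`, `g₀ ↦ -1`, with values in `Aˣ`: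
a homomorphism `s` with `s g = 1 ↔ g = 1`-style control (`s 1 = 1`, `s g = -1` for `g ≠ 1`) and
values `±1`. [folklore] -/
theorem exists_signChar_of_card_eq_two (hG : Nat.card G = 2) :
    ∃ s : G →* Aˣ, (∀ g, g ≠ 1 → s g = -1) ∧ ∀ g, s g = 1 ∨ s g = -1 := by
  obtain ⟨g₀, hg₀, huniq⟩ := (Nat.card_eq_two_iff' (1 : G)).mp hG
  have hall : ∀ g : G, g = 1 ∨ g = g₀ := fun g => (eq_or_ne g 1).imp id (huniq g)
  have hsq : g₀ * g₀ = 1 := by rw [← pow_two, ← hG]; exact pow_card_eq_one'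
  refine ⟨⟨⟨fun g => if g = 1 then 1 else -1, if_pos rfl⟩, fun g h => ?_⟩,
    fun g hg => if_neg hg, fun g => ?_⟩
  · change (if g * h = 1 then (1 : Aˣ) else -1) = (if g = 1 then 1 else -1) * (if h = 1 then 1 else -1)
    rcases hall g with rfl | rfl <;> rcases hall h with rfl | rfl
    · simp
    · simp [hg₀]
    · simp [hg₀]
    · rw [hsq, if_pos rfl, if_neg hg₀]
      simp
  · change (if g = 1 then (1 : Aˣ) else -1) = 1 ∨ (if g = 1 then (1 : Aˣ) else -1) = -1
    split_ifs <;> simp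

end TwoElement

section Irreducible

variable {K : Type} [Field K] [NumberField K] {k : Type*} [Field k] [TopologicalSpace k]
  [IsTopologicalRing k]

/-- **If `ρ : Γ_K → GL₂(k)` is irreducible but `ρ|_{Γ_E}` is not (`E/K` quadratic), then `tr ρ`
vanishes off `res(Γ_E)`.**  Let `L` be a `res(Γ_E)`-stable line and `g ∉ res(Γ_E)`; then
`L' = ρ(g) L` is `res(Γ_E)`-stable (`res(Γ_E)` is normal), `L ≠ L'` (otherwise `L` is
`Γ_K`-stable), so `k² = L ⊕ L'`, and `ρ(g)` exchanges `L` and `L'` (`g² ∈ res(Γ_E)`), hence has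
trace `0` (`LinearMap.trace_eq_zero_of_mapsTo_of_isCompl`).  (Clifford; Serre, *Linear
representations*, §8.1.) [folklore] -/
theorem FramedGaloisRep.trace_eq_zero_of_not_isIrreducible_restrictField (E : Type) [Field E]
    [Algebra K E] (hdeg : Module.finrank K E = 2) (ρ : FramedGaloisRep K k 2)
    (hirr : ρ.toGaloisRep.IsIrreducible) (hred : ¬ (ρ.restrictField E).toGaloisRep.IsIrreducible)
    {g : absoluteGaloisGroup K} (hg : g ∉ (absGaloisRestrict K E).range) :
    FramedRep.trace ρ g = 0 := by
  classical
  haveI : FiniteDimensional K E := Module.finite_of_finrank_pos (by rw [hdeg]; exact two_pos)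
  haveI : Algebra.IsQuadraticExtension K E := ⟨hdeg⟩
  haveI : IsGalois K E := inferInstance
  set H : Subgroup (absoluteGaloisGroup K) := (absGaloisRestrict K E).range with hHdef
  haveI hHn : H.Normal := normal_range_absGaloisRestrict K E
  -- cosets of the index-two subgroup `H`
  have hcard : Nat.card (E ≃ₐ[K] E) = 2 := (IsGalois.card_aut_eq_finrank K E).trans hdeg
  obtain ⟨σ₀, hσ₀, huniq⟩ := (Nat.card_eq_two_iff' (1 : E ≃ₐ[K] E)).mp hcard
  have hsq : σ₀ * σ₀ = 1 := by rw [← pow_two, ← hcard]; exact pow_card_eq_one'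
  have hq : ∀ τ : absoluteGaloisGroup K, τ ∉ H → absGaloisQuot K E τ = σ₀ := fun τ hτ ↦
    huniq _ (mt (absGaloisQuot_eq_one_iff K E τ).1 hτ)
  have hmul : ∀ τ τ' : absoluteGaloisGroup K, τ ∉ H → τ' ∉ H → τ * τ' ∈ H := fun τ τ' hτ hτ' ↦
    (absGaloisQuot_eq_one_iff K E _).1 (by rw [map_mul, hq τ hτ, hq τ' hτ', hsq])
  have hinvmul : ∀ τ τ' : absoluteGaloisGroup K, τ ∉ H → τ' ∉ H → τ⁻¹ * τ' ∈ H :=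
    fun τ τ' hτ hτ' ↦ (absGaloisQuot_eq_one_iff K E _).1 (by
      rw [map_mul, map_inv, hq τ hτ, hq τ' hτ', inv_mul_cancel])
  -- the representations
  set ρK : Representation k (absoluteGaloisGroup K) (Fin 2 → k) := ρ.toGaloisRep.toRepresentation
    with hρK
  have hρKinv : ∀ τ : absoluteGaloisGroup K, ρK τ⁻¹ * ρK τ = 1 := fun τ ↦ by
    rw [← map_mul, inv_mul_cancel, map_one]
  have hρKinj : ∀ τ : absoluteGaloisGroup K, Function.Injective (ρK τ) := fun τ ↦
    Function.LeftInverse.injective (g := ρK τ⁻¹) fun x ↦ by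
      change (ρK τ⁻¹ * ρK τ) x = x
      rw [hρKinv, Module.End.one_apply]
  -- a proper non-zero subrepresentation of `ρ|_{Γ_E}`
  have hV2 : Module.finrank k (Fin 2 → k) = 2 := Module.finrank_fin_fun k
  obtain ⟨W, hWbot, hWtop⟩ : ∃ W : Subrepresentation (ρ.restrictField E).toGaloisRep.toRepresentation,
      W ≠ ⊥ ∧ W ≠ ⊤ := by
    by_contra hno
    push Not at hno
    apply hred
    have hbt : (⊥ : Subrepresentation (ρ.restrictField E).toGaloisRep.toRepresentation) ≠ ⊤ := by
      intro h
      have h' := congrArg Subrepresentation.toSubmodule h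
      change (⊥ : Submodule k (Fin 2 → k)) = ⊤ at h'
      exact bot_ne_top h'
    exact { exists_pair_ne := ⟨⊥, ⊤, hbt⟩,
            eq_bot_or_eq_top := fun W => (eq_or_ne W ⊥).imp_right (hno W) }
  set L : Submodule k (Fin 2 → k) := W.toSubmodule with hLdef
  have hLbot : L ≠ ⊥ := fun h ↦ hWbot (Subrepresentation.toSubmodule_injective h)
  have hLtop : L ≠ ⊤ := fun h ↦ hWtop (Subrepresentation.toSubmodule_injective h)
  have hLstab : ∀ τ ∈ H, ∀ x ∈ L, ρK τ x ∈ L := by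
    rintro τ ⟨δ, rfl⟩ x hx
    exact W.apply_mem_toSubmodule δ hx
  have hL1 : Module.finrank k L = 1 := by
    have h1 : Module.finrank k L < 2 := (Submodule.finrank_lt hLtop).trans_eq hV2
    have h2 : Module.finrank k L ≠ 0 := fun h ↦ hLbot (Submodule.finrank_eq_zero.mp h)
    omega
  -- its translate `L' = ρ(g) L`
  set L' : Submodule k (Fin 2 → k) := L.map (ρK g) with hL'def
  have hL'1 : Module.finrank k L' = 1 := by
    rw [hL'def, ← hL1]
    exact (LinearEquiv.finrank_eq (Submodule.equivMapOfInjective _ (hρKinj g) L)).symm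
  have hL'stab : ∀ τ ∈ H, ∀ x ∈ L', ρK τ x ∈ L' := by
    intro τ hτ x hx
    obtain ⟨y, hy, rfl⟩ := Submodule.mem_map.mp hx
    refine Submodule.mem_map.mpr ⟨ρK (g⁻¹ * τ * g) y, hLstab _ ?_ y hy, ?_⟩
    · have := hHn.conj_mem _ hτ g⁻¹
      rwa [inv_inv] at this
    · change (ρK g * ρK (g⁻¹ * τ * g)) y = (ρK τ * ρK g) y
      rw [← map_mul, ← map_mul, ← mul_assoc, ← mul_assoc, mul_inv_cancel, one_mul]
  have hLL' : L ≠ L' := by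
    intro hLL'
    -- then `L` is `Γ_K`-stable, contradicting the irreducibility of `ρ`
    have hstab : ∀ (τ : absoluteGaloisGroup K), ∀ x ∈ L, ρK τ x ∈ L := by
      intro τ x hx
      by_cases hτ : τ ∈ H
      · exact hLstab τ hτ x hx
      · have h1 : ρK τ x = ρK g (ρK (g⁻¹ * τ) x) := by
          change _ = (ρK g * ρK (g⁻¹ * τ)) x
          rw [← map_mul, ← mul_assoc, mul_inv_cancel, one_mul]
        rw [h1]
        have h2 : ρK (g⁻¹ * τ) x ∈ L := hLstab _ (hinvmul g τ hg hτ) x hx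
        have h3 : ρK g (ρK (g⁻¹ * τ) x) ∈ L' := Submodule.mem_map_of_mem h2
        rwa [← hLL'] at h3
    let WK : Subrepresentation ρK := ⟨L, fun τ x hx => hstab τ x hx⟩
    haveI := hirr
    rcases IsSimpleOrder.eq_bot_or_eq_top WK with h0 | h1
    · exact hLbot (congrArg Subrepresentation.toSubmodule h0)
    · exact hLtop (congrArg Subrepresentation.toSubmodule h1)
  -- `k² = L ⊕ L'`
  have hinf : L ⊓ L' = ⊥ := by
    by_contra hne
    have h1 : Module.finrank k ↥(L ⊓ L') ≠ 0 := fun h ↦ hne (Submodule.finrank_eq_zero.mp h)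
    have h2 : Module.finrank k ↥(L ⊓ L') ≤ 1 := hL1 ▸ Submodule.finrank_mono inf_le_left
    have h3 : L ⊓ L' = L :=
      Submodule.eq_of_le_of_finrank_eq inf_le_left (by omega)
    have h4 : L ≤ L' := h3 ▸ inf_le_right
    exact hLL' (Submodule.eq_of_le_of_finrank_eq h4 (hL1.trans hL'1.symm))
  have hsup : L ⊔ L' = ⊤ := by
    have h1 := Submodule.finrank_sup_add_finrank_inf_eq L L'
    rw [hinf, finrank_bot, add_zero, hL1, hL'1] at h1
    exact Submodule.eq_top_of_finrank_eq (h1.trans hV2.symm)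
  have hcompl : IsCompl L L' := ⟨disjoint_iff.mpr hinf, codisjoint_iff.mpr hsup⟩
  -- `ρ(g)` exchanges `L` and `L'`
  have hex1 : ∀ x ∈ L, ρK g x ∈ L' := fun x hx ↦ Submodule.mem_map_of_mem hx
  have hex2 : ∀ x ∈ L', ρK g x ∈ L := by
    intro x hx
    obtain ⟨y, hy, rfl⟩ := Submodule.mem_map.mp hx
    change (ρK g * ρK g) y ∈ L
    rw [← map_mul]
    exact hLstab _ (hmul g g hg hg) y hy
  have htr := LinearMap.trace_eq_zero_of_mapsTo_of_isCompl hcompl (ρK g) hex1 hex2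
  rw [← FramedGaloisRep.character_toRepresentation]
  exact htr

/-- **An element off `res(Γ_E)` of non-zero trace makes `ρ|_{Γ_E}` irreducible** (contrapositive
of `trace_eq_zero_of_not_isIrreducible_restrictField`), for `ρ : Γ_K → GL₂(k)` irreducible and
`E/K` quadratic. [folklore] -/
theorem FramedGaloisRep.isIrreducible_restrictField_of_trace_ne_zero (E : Type) [Field E]
    [Algebra K E] (hdeg : Module.finrank K E = 2) (ρ : FramedGaloisRep K k 2)
    (hirr : ρ.toGaloisRep.IsIrreducible) {g : absoluteGaloisGroup K}
    (hg : g ∉ (absGaloisRestrict K E).range) (htr : FramedRep.trace ρ g ≠ 0) :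
    (ρ.restrictField E).toGaloisRep.IsIrreducible := by
  by_contra hred
  exact htr (ρ.trace_eq_zero_of_not_isIrreducible_restrictField E hdeg hirr hred hg)

end Irreducible

/-! ## 5. The quadratic character of `Γ_K` cut out by a quadratic `L ⊆ K̄`, and inert places -/

section QuadGaloisChar

variable {K : Type*} [Field K] (L : IntermediateField K (AlgebraicClosure K))
  [FiniteDimensional K L] [IsGalois K L]
  (A : Type*) [CommRing A] [TopologicalSpace A] [IsTopologicalRing A]

/-- **The quadratic Galois character `ε_L : Γ_K → Aˣ`** of a quadratic Galois subextension
`L ⊆ K̄`: the sign character of `Gal(L/K)` inflated along `Γ_K → Gal(L/K)` (continuous: its kernel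
contains the open subgroup `Gal(K̄/L)`).  It is `1` exactly on the `γ` with `γ|_L = 1` and `-1`
elsewhere. [folklore] -/
theorem exists_quadraticGaloisChar (hL : Nat.card (L ≃ₐ[K] L) = 2) :
    ∃ ε : absoluteGaloisGroup K →ₜ* Aˣ, (∀ γ, absRestrictNormalHom L γ = 1 → ε γ = 1) ∧
      (∀ γ, absRestrictNormalHom L γ ≠ 1 → ε γ = -1) ∧ (∀ γ, ε γ = 1 ∨ ε γ = -1) := by
  obtain ⟨s, hs', hs⟩ := exists_signChar_of_card_eq_two A hL
  refine ⟨⟨s.comp (absRestrictNormalHom L), MonoidHom.continuous_of_isOpen_ker _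
      (Subgroup.isOpen_mono (fun γ hγ => ?_) (isOpen_ker_absRestrictNormalHom L))⟩,
    fun γ hγ => ?_, fun γ hγ => ?_, fun γ => hs _⟩
  · rw [MonoidHom.mem_ker] at hγ ⊢
    rw [MonoidHom.comp_apply, hγ, map_one]
  · change s (absRestrictNormalHom L γ) = 1
    rw [hγ, map_one]
  · change s (absRestrictNormalHom L γ) = -1
    exact hs' _ hγ

variable [NumberField K] [NumberField L] {L A}

omit [FiniteDimensional K L] [IsTopologicalRing A] [IsGalois K L] in
/-- **A Frobenius above a prime unramified and of residue degree one in an abelian `L` restricts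
trivially to `L`**: it restricts to `Frob_v ∈ Gal(L/K)` (`eq_galFrob`), and `Frob_v^{f_v} = 1`
with `f_v = 1`. [cite: NeukirchANT1999, Ch. I §9 Prop. (9.4)] -/
theorem absRestrictNormalHom_eq_one_of_isArithFrobAt_of_inertiaDegIn_eq_one [IsGalois K L]
    (hcomm : ∀ a b : L ≃ₐ[K] L, Commute a b)
    {v : HeightOneSpectrum (𝓞 K)} (hunr : Algebra.IsUnramifiedIn (𝓞 L) v.asIdeal)
    (hf : v.asIdeal.inertiaDegIn (𝓞 L) = 1)
    {𝔓 : Ideal (absIntegers (𝓞 K) K)} (h𝔓 : 𝔓 ∈ v.primesAbove) {Φ : absoluteGaloisGroup K}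
    (hΦ : IsArithFrobAt (𝓞 K) Φ 𝔓) : absRestrictNormalHom L Φ = 1 := by
  haveI : 𝔓.IsPrime := h𝔓.1
  have hP := comap_ringOfIntegersToIntegralClosure_mem_primesOver_of_mem_primesAbove L h𝔓
  have hrΦ := isArithFrobAt_absRestrictNormalHom L hΦ
  have heq : absRestrictNormalHom L Φ = galFrob K L v := eq_galFrob hcomm hunr hP hrΦ
  have hone : galFrob K L v = 1 := by
    have h := Automorphic.galFrob_pow_inertiaDegIn_eq_one (F := K) (L := L) hunr
    rwa [hf, pow_one] at h
  exact heq.trans hone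

end QuadGaloisChar

end Literature.NumberTheory.GaloisRepresentations

/-! ## 6. The hypothesis of `baseChange_cyclic_cuspidal` from one element of non-zero trace -/

namespace Literature.NumberTheory.Automorphic

open Literature.NumberTheory.GaloisRepresentations

section Inert

/-- `2 × 2` matrices: if `charpoly M = (X - x)(X - y)` then `tr M = x + y`. [folklore] -/
theorem Matrix.trace_eq_of_charpoly_eq_fin_two {k : Type*} [Field k] (M : Matrix (Fin 2) (Fin 2) k)
    {x y : k} (h : M.charpoly = (X - C x) * (X - C y)) : M.trace = x + y := by
  have h' : (X ^ 2 - C M.trace * X + C M.det : k[X]) = X ^ 2 - C (x + y) * X + C (x * y) := by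
    rw [← Matrix.charpoly_fin_two, h, map_add, map_mul]; ring
  have h1 := congrArg (fun p : k[X] => p.coeff 1) h'
  have h1' : -M.trace = -y + -x := by simpa using h1
  linear_combination -h1'

variable {p : ℕ} [Fact p.Prime] {K : Type} [Field K] [NumberField K]

open scoped Classical in
/-- **The hypothesis of `baseChange_cyclic_cuspidal` from one element off `res(Γ_E)` with
non-zero trace** (Galois form of Ribet 1977, §4: `π` has CM by `E` iff `a_v(π) = 0` at the inert
`v`).  Let `E/K` be a quadratic extension of number fields, `π` an automorphic representation of
`GL₂(𝔸_K)`, `ρ : Γ_K → GL₂(ℚ̄_p)` Satake–Frobenius compatible with `π` at almost every place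
(L-normalisation), and suppose some `γ ∈ Γ_K ∖ res(Γ_E)` has `tr ρ(γ) ≠ 0`.  Then at some place
`v` of `K` inert in `E` (a place `w ∣ v` of residue degree `[E:K]`) `π` has a Satake parameter `α`
with `ζ • α ≠ α` for every primitive square root of unity `ζ` (i.e. `-α ≠ α`).  Proof: the set
`{ε_E = -1} ∩ {tr ρ ≠ 0}` is open (`ε_E` the quadratic character of a copy of `E` in `K̄`,
continuous; `tr ρ` continuous) and contains `γ` (`ε_E(γ) = -1` as `γ ∉ res(Γ_E) = ker ε_E`); by
the density of Frobenii (`absoluteGaloisGroup.frobenius_dense`, `chebotarev_artinRep_holds`) it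
contains an arithmetic Frobenius `Φ` at a prime above a place `v` where `ρ` and `π` are
compatible and `v` is unramified in `E`; `ε_E(Φ) = -1` forces `f(w|v) = 2`
(`quadraticGaloisChar_eq_one_of_isArithFrobAt`), and if `-α = α` for `α = {a, b}` then `a + b = 0`
and `tr ρ(Φ) = ι⁻¹(a⁻¹) + ι⁻¹(b⁻¹) = 0`, a contradiction.
[cite: Ribet1977Nebentypus, §4 (Prop. 4.4, Thm. 4.5)] -/
theorem exists_inert_hasSatakeParamAt_map_ne_of_trace_ne_zero (E : Type) [Field E] [NumberField E]
    [Algebra K E] (hdeg : Module.finrank K E = 2) {hcpt : isCompact_glFiniteIntegralLevel 2 K}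
    (ι : PadicAlgCl p ≃+* ℂ) (π : AutomorphicRepData (AutomorphyDatum.gl 2 K hcpt))
    (ρ : FramedGaloisRep K (PadicAlgCl p) 2)
    (hcompat : ∀ᶠ v : HeightOneSpectrum (𝓞 K) in cofinite, ∃ α : Multiset ℂ,
      π.HasSatakeParamAt v α ∧ ρ.IsUnramifiedAt v ∧
        ρ.HasFrobCharpolyAt v (arithFrobPolyOfSatake ι v.residueCard 1 α))
    (hγ : ∃ γ : absoluteGaloisGroup K, γ ∉ (absGaloisRestrict K E).range ∧ FramedRep.trace ρ γ ≠ 0) :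
    ∃ (v : HeightOneSpectrum (𝓞 K)) (w : HeightOneSpectrum (𝓞 E)) (α : Multiset ℂ),
      w.asIdeal.under (𝓞 K) = v.asIdeal ∧ w.asIdeal.inertiaDeg (𝓞 K) = Module.finrank K E ∧
      π.HasSatakeParamAt v α ∧
      ∀ ζ : ℂ, IsPrimitiveRoot ζ (Module.finrank K E) → α.map (ζ * ·) ≠ α := by
  by_contra H
  push Not at H
  -- (0) `E/K` is Galois; a copy `L ⊆ K̄` of `E` with `res(Γ_E) = Gal(K̄/L)`
  haveI : FiniteDimensional K E := Module.finite_of_finrank_pos (by rw [hdeg]; exact two_pos)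
  haveI : Algebra.IsQuadraticExtension K E := ⟨hdeg⟩
  haveI : IsGalois K E := inferInstance
  obtain ⟨e, he⟩ := exists_mem_range_absGaloisRestrict_iff K E
  obtain ⟨L, hLdef⟩ : ∃ L, L = e.fieldRange := ⟨_, rfl⟩
  let e' : E ≃ₐ[K] L := e.equivFieldRange.trans (IntermediateField.equivOfEq hLdef.symm)
  haveI := e'.toLinearEquiv.finiteDimensional
  haveI hGL := IsGalois.of_algEquiv e'
  haveI : NumberField L := NumberField.of_module_finite K L
  have hL2 : Module.finrank K L = 2 := e'.toLinearEquiv.finrank_eq ▸ hdeg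
  have hcard : Nat.card (L ≃ₐ[K] L) = 2 := (IsGalois.card_aut_eq_finrank K L).trans hL2
  haveI : IsCyclic (L ≃ₐ[K] L) := isCyclic_of_prime_card (p := 2) hcard
  haveI : IsMulCommutative (L ≃ₐ[K] L) := IsCyclic.isMulCommutative
  have hcomm : ∀ a b : L ≃ₐ[K] L, Commute a b := fun a b => IsMulCommutative.is_comm.comm a b
  -- (1) the quadratic character; `ε γ = -1`
  obtain ⟨ε, hεL, hεN, -⟩ := exists_quadraticGaloisChar L (PadicAlgCl p) hcard
  obtain ⟨γ, hγres, hγtr⟩ := hγ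
  have hγL : absRestrictNormalHom L γ ≠ 1 := by
    intro h1
    apply hγres
    rw [he]
    intro x
    rw [absRestrictNormalHom_eq_one_iff, IntermediateField.mem_fixingSubgroup_iff] at h1
    have hx : e x ∈ L := by rw [hLdef]; exact ⟨x, rfl⟩
    have h2 := h1 (e x) hx
    rwa [absoluteGaloisGroup.smul_def]
  have hεγ : ε γ = -1 := hεN γ hγL
  have h11 : ((-1 : (PadicAlgCl p)ˣ)) ≠ 1 := fun h ↦ by
    have h2 : ((-1 : (PadicAlgCl p)ˣ) : PadicAlgCl p) = ((1 : (PadicAlgCl p)ˣ) : PadicAlgCl p) := by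
      rw [h]
    rw [Units.val_neg, Units.val_one] at h2
    exact two_ne_zero (α := PadicAlgCl p) (by linear_combination -h2)
  -- (2) the open set `{ε = -1, tr ρ ≠ 0}` and a Frobenius in it
  set U : Set (absoluteGaloisGroup K) := {g | ε g ≠ 1} ∩ {g | FramedRep.trace ρ g ≠ 0} with hU
  have hUo : IsOpen U :=
    (isOpen_ne_fun (map_continuous ε) continuous_const).inter
      (isOpen_ne_fun (FramedRep.continuous_trace ρ) continuous_const)
  have hγU : γ ∈ U := ⟨by rw [Set.mem_setOf_eq, hεγ]; exact h11, hγtr⟩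
  set S : Set (HeightOneSpectrum (𝓞 K)) := {v | ¬ ((∃ α : Multiset ℂ,
      π.HasSatakeParamAt v α ∧ ρ.IsUnramifiedAt v ∧
        ρ.HasFrobCharpolyAt v (arithFrobPolyOfSatake ι v.residueCard 1 α)) ∧
      Algebra.IsUnramifiedIn (𝓞 L) v.asIdeal)} with hS
  have hSfin : S.Finite := by
    have h := hcompat.and (eventually_isUnramifiedIn (K := K) L)
    rwa [eventually_cofinite] at h
  obtain ⟨Φ, ⟨hΦε, hΦtr⟩, v, hvS, 𝔓, h𝔓, hΦ⟩ :=
    (absoluteGaloisGroup.frobenius_dense chebotarev_artinRep_holds K S hSfin).inter_open_nonempty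
      U hUo ⟨γ, hγU⟩
  have hv : (∃ α : Multiset ℂ, π.HasSatakeParamAt v α ∧ ρ.IsUnramifiedAt v ∧
      ρ.HasFrobCharpolyAt v (arithFrobPolyOfSatake ι v.residueCard 1 α)) ∧
      Algebra.IsUnramifiedIn (𝓞 L) v.asIdeal := by
    by_contra h; exact hvS h
  obtain ⟨⟨α, hα, hunr, hP⟩, hvL⟩ := hv
  -- (3) `v` is inert in `E`
  haveI : IsGaloisGroup (E ≃ₐ[K] E) (𝓞 K) (𝓞 E) := IsGaloisGroup.of_isFractionRing _ _ _ K E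
  obtain ⟨w, hw⟩ := exists_above (E := E) v
  have hf2 : w.asIdeal.inertiaDeg (𝓞 K) = 2 := by
    rcases inertiaDeg_eq_one_or_two_of_finrank_eq_two hdeg v w hw with hf1 | hf2
    · exfalso
      haveI : w.asIdeal.LiesOver v.asIdeal := ⟨hw.symm⟩
      haveI := v.isMaximal
      have hIn : v.asIdeal.inertiaDegIn (𝓞 L) = 1 := by
        rw [← inertiaDegIn_eq_of_algEquiv e' v.asIdeal,
          Ideal.inertiaDegIn_eq_inertiaDeg v.asIdeal w.asIdeal (E ≃ₐ[K] E)]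
        exact hf1
      exact hΦε (hεL Φ
        (absRestrictNormalHom_eq_one_of_isArithFrobAt_of_inertiaDegIn_eq_one hcomm hvL hIn h𝔓 hΦ))
    · exact hf2
  obtain ⟨ζ, hζ, hαζ⟩ := H v w α hw (hf2.trans hdeg.symm) hα
  rw [hdeg] at hζ
  obtain rfl : ζ = -1 := hζ.eq_neg_one_of_two_right
  -- (4) `α = {a, b}` with `{-a, -b} = {a, b}`, so `a + b = 0` and `tr ρ(Φ) = 0`
  obtain ⟨a, b, rfl⟩ := Multiset.card_eq_two.mp hα.card_eq
  have hsum : a + b = 0 := by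
    have h1 := congrArg Multiset.sum hαζ
    simp only [Multiset.insert_eq_cons, Multiset.map_cons, Multiset.map_singleton,
      Multiset.sum_cons, Multiset.sum_singleton, neg_mul, one_mul] at h1
    linear_combination -h1 / 2
  have hch : FramedRep.charpoly ρ Φ = arithFrobPolyOfSatake ι v.residueCard 1 (a ::ₘ {b}) := by
    have := hP 𝔓 h𝔓 Φ hΦ
    simpa only [Multiset.insert_eq_cons] using this
  have hch' : ((ρ Φ : GL (Fin 2) (PadicAlgCl p)) : Matrix (Fin 2) (Fin 2) (PadicAlgCl p)).charpoly =
      (X - C (ι.symm a⁻¹)) * (X - C (ι.symm b⁻¹)) := by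
    rw [FramedRep.charpoly, arithFrobPolyOfSatake_one] at hch
    simpa only [Multiset.map_cons, Multiset.map_singleton, Multiset.prod_cons,
      Multiset.prod_singleton] using hch
  have htr : FramedRep.trace ρ Φ = ι.symm a⁻¹ + ι.symm b⁻¹ :=
    Matrix.trace_eq_of_charpoly_eq_fin_two _ hch'
  have hb : b = -a := by linear_combination hsum
  rw [hb, inv_neg, map_neg, add_neg_cancel] at htr
  exact hΦtr htr

end Inert

end Literature.NumberTheory.Automorphic

end
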